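import Summits.BirchSwinnertonDyer.Rank1Residual.GaloisImage.KatoZetaValueDerivativeExpansion
import HarnessLib

/-!
# The derivative congruence between Kato's zeta value and the twisted Mazur–Tate element
# (PK-4b-C's OUT: the `hmem` socket of T-PK6-VAL `KatoKuriharaValueOfComparison`)
# (cell `b2b-bsdres`, team n1011, ROUTE-1 PORT anatomy (P-KIM); R1-71/R1-72: PK-4b
# `KatoZetaValueDerivativeCongruence`, layer PK-4b-C4b-2 (iv); seat p15 GEN 10)

HONEST FRAMING (cell `b2b-bsdres`, run/shared/lean/b2b/bsd-rank1-residual/, verbatim in every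
file): the goal of the cell is to DELETE the COMBINATION-SHAPED residual classes of the
Birch–Swinnerton-Dyer formula for ALL analytic-rank `≤ 1` elliptic curves over `ℚ` — "full BSD
formula for every rank `≤ 1` curve in class `C`" assembled STRICTLY from published theorems — so
that the rank-`≤ 1` remainder becomes exactly the CONSTRUCTION-SHAPED classes, which are TYPED
(missing-input `Prop`s), NOT attempted. This is not "finishing BSD". Team n1011 (N10/N11; ROUTE 1,
the PORT anatomy (P-KIM) of class X4 ∧ `p = 3`): research route on CONSTRUCTION-SHAPED classes;
prove what is provable now; no claim beyond stated classes; census output = EVIDENCE, never a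
Literature fact; RESIDUAL-MAP marks UNCHANGED; nothing is booked by this file. TOOL THEOREMS ONLY:
no definition, no named fact, no instance, no `sorry`; Kato's value law enters as the DISPLAYED
hypothesis `hval` (PK-4a's literal conclusion shape); the `p`-integral structures `Θ` (PK-3's `hΘ`
verbatim) and `V` (the twist; its integrality = the row's depletion / 𝔊⁻ certificates) are DISPLAYED.

## What

Data as in `KatoZetaValueDerivativeExpansion` (whose docstring fixes the notation), plus a prime
`p ≠ 2` with `p^K ∣ ℓ_i − 1` (Kolyvagin primes), `p`-integrality of the symbols `[t/m]⁺_f`, `m ∣ n`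
(`hint`), `Θ ∈ ℤ_p[(ℤ/n)ˣ]` with coefficients `[a/n]⁺_f` (PK-3's `hΘ`) and an integral lift `V^int` of
the twist `V` (`hV`).
★★ `prod_deriv_mul_plusAvatar_sub_mem_map_span` — THE CONGRUENCE:
`(∏_i Σ_{j<ℓ_i−1} j δ_{b_i^j}) · ((n • (1 + δ₋₁)X)^{ℚ_p} − (Θ·V^int)^{ℚ_p}) ∈` the image of `p^K ℤ_p[(ℤ/n)ˣ]`
— TOKEN-FOR-TOKEN the `hmem` of T-PK6-VAL ★★
`GroupRingEval.exists_mem_cycIntLattice_symm_deriv_sub_tmul_eq_pow_smul_of_mem_map_span` (n1011-p02;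
`c₀ = n`, `d = univ`, `N_i = ℓ_i − 1`, its `Θ` := `Θ·V^int`, so that its `hD` is PK-3's identity
twisted by `V^int` via `mapRingHom_mul_mul_prod_deriv_eq_smul`). Mechanism (r1 GEN 45, P57-a): the
expansion mapped to `ℚ_p[(ℤ/n)ˣ]` and PK-4b-C3 `sum_mem_map_of_images` — `g_i = (ℓ_i − 2)/2 ∈ ℤ_p`
(`p ≠ 2`), `D_i`, `N_i` integral, the lower pull-backs `V·Θ_d` integral (`hint`, `hV`), and
`K_i − M_i = (1 − ℓ_i)δ_{λ_i} ∈ p^K ℤ_p[(ℤ/n)ˣ]`; NO `a_ℓ ≡ 2`, NO Taylor expansion, NO integrality of `X`.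
Tools for `hV` (§ Integral lifts): coefficientwise `p`-integral elements lift, lifts multiply, and the
depletion factor at an ADDITIVE prime (`a_p = 0`, `p ∣ N` — the cell's X4 ∧ `p = 3`) is `1`, so `V`
lifts as soon as `κ`, the `a_q/q`, `q⁻¹` (`q ∣ A`, `q ≠ p`) and the four cusp coefficients are
`p`-integral (the row's depletion / 𝔊⁻ certificates, displayed as in `KatoKuriharaValueEmptyLevel`).
HONEST LIMITS: `hval`, `Θ`, `V^int`, `hint` are displayed hypotheses (discharged by PK-4a
`charSum_eq_of_even` from `ZetaBody`, by `IsNewformOf.norm_ratPlusSymbol_div_le_one`, and by the row's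
certificates); at a GOOD or MULTIPLICATIVE `p` the factor `E_p` is not `p`-integral and a `p^t`-scaled
variant would be needed — NOT provided here; no `hval` of PK-5 is assembled here (that is T-PK6-VAL,
n1011-p02); closes nothing; books nothing.

References: K. Kato, Astérisque 295 (2004) Thm. 6.6 (1) p. 163, §6.2 p. 161 [Kato2004Asterisque];
K. Rubin, *Euler Systems* (2000) §4.4, §9.6 [Rubin2000]; C.-H. Kim, AJM 148 (2026) = arXiv:2203.12159,
proof of Thm. 3.13 [Kim2022StructureSelmer]; C.-H. Kim, K. Nakamura, JNT 210 (2020) Prop. 3.5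
[KimNakamura2020]; r1 ROUTE-1 §55–57 R1-71/R1-72 (cells/n1011/ROUTE-1.md);
`HOME/b2b-bsdres-n1011-p15/g9/pk4/PK4b-C4-DESIGN.md`.
-/

noncomputable section

namespace Summit.BirchSwinnertonDyer.Rank1Residual.GaloisImage

namespace EulerFactorComparison

open Finset MonoidAlgebra
open scoped BigOperators
open Literature.NumberTheory.EllipticCurves Literature.NumberTheory.EllipticCurves.ModularForms
open Literature.NumberTheory.EllipticCurves.Kato2004.EulerSystemValues
open CongruenceSubgroup

variable {ι : Type*} [Fintype ι] [DecidableEq ι] (ℓ : ι → ℕ) [hℓ : ∀ i, Fact (ℓ i).Prime]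
  (hinj : Function.Injective ℓ) {n : ℕ} [NeZero n] (hn : ∏ i, ℓ i = n)
  {N : ℕ} [NeZero N] (f : CuspForm (Gamma0 N) 2)

/-! ### ★★ The congruence: PK-4b-C's OUT in the `hmem` currency of T-PK6-VAL -/

set_option backward.isDefEq.respectTransparency false in
include hinj in
/-- **★★ THE DERIVATIVE CONGRUENCE (PK-4b-C's OUT).** Data as in `prod_deriv_mul_plusAvatar_sub_eq_sum`
(value law `hval` DISPLAYED), a prime `p ≠ 2` with `p^K ∣ ℓ_i − 1` for every `i` (Kolyvagin primes),
`p`-integrality of the symbols `[t/m]⁺_f`, `m ∣ n` (`hint`), an integral structure `Θ ∈ ℤ_p[(ℤ/n)ˣ]`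
of `θ̃_f(n)` (PK-3's `hΘ`: coefficients `[a/n]⁺_f`) and an integral lift `V` of the twist
`(1 + δ₋₁) · κδ_{u⁻¹} · E · C⁻` (`hV`). Then
`(∏_i Σ_{j<ℓ_i−1} j δ_{b_i^j}) · ((n • (1 + δ₋₁)·X)^{ℚ_p} − (Θ·V)^{ℚ_p}) ∈` the image of `p^K · ℤ_p[(ℤ/n)ˣ]`
— the hypothesis `hmem` of T-PK6-VAL
`GroupRingEval.exists_mem_cycIntLattice_symm_deriv_sub_tmul_eq_pow_smul_of_mem_map_span` (`c₀ = n`,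
`d = univ`, `N_i = ℓ_i − 1`, its `Θ` := `Θ·V`). Proof: the expansion of §2 mapped to `ℚ_p[(ℤ/n)ˣ]` and
PK-4b-C3 `sum_mem_map_of_images`: `g_i = (ℓ_i − 2)/2 ∈ ℤ_p` (`p ≠ 2`), `D_i`, `N_i` integral, the lower
pull-backs `V·Θ_d` integral (`hint`, `hV`), and `K_i − M_i = (1 − ℓ_i)δ_{λ_i} ∈ p^K ℤ_p[(ℤ/n)ˣ]`; no
integrality of `X` is used. [cite: Kim2022StructureSelmer, the proof of Thm. 3.13 (arXiv v3 pp. 26–28; = Thm. 3.11 of AJM 148)]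
[cite: Kato2004Asterisque, Thm. 6.6 (1) (p. 163) and §6.2 (p. 161)] [cite: Rubin2000, §9.6 and §4.4] -/
theorem prod_deriv_mul_plusAvatar_sub_mem_map_span (hf : IsNewform0 f) (hQ : coeffField f = ⊥)
    (hℓN : ∀ i, ¬ ℓ i ∣ N) (aℓ : ι → ℤ) (ha : ∀ i, cuspCoeff f (ℓ i) = aℓ i)
    (x : CyclotomicField n ℚ) (X : MonoidAlgebra ℚ (ZMod n)ˣ)
    (hxX : x = ∑ g : (ZMod n)ˣ, X.coeff g •
      sigma n g (IsCyclotomicExtension.zeta n ℚ (CyclotomicField n ℚ)))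
    (ιe : CyclotomicField n ℚ →+* ℂ) (u : (ZMod n)ˣ)
    (hι : ιe (IsCyclotomicExtension.zeta n ℚ (CyclotomicField n ℚ)) =
      Complex.exp (2 * Real.pi * Complex.I * ((u : ZMod n).val : ℂ) / n))
    (κ : ℚ) {M : ℕ} (hM0 : M ≠ 0) (hM : M.Coprime n) (c d a : ℤ) (A : ℕ) (d' : ℤ)
    (hval : ∀ {n₀ : ℕ} [NeZero n₀] (hn₀ : n₀ ∣ n) {χ₀ : DirichletCharacter ℂ n₀},
      χ₀.IsPrimitive → χ₀ (-1) = 1 →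
      charSum n ιe (DirichletCharacter.changeLevel hn₀ χ₀) x =
        (κ : ℂ) * ((∏ q ∈ (n * M).primeFactors.filter (fun q => ¬ q ∣ n₀),
            (1 - χ₀ (q : ZMod n₀) * cuspCoeff f q * (q : ℂ) ^ (-(1 : ℂ)) +
              (if q ∣ N then 0 else (q : ℂ)) * χ₀ (q : ZMod n₀) ^ 2 * ((q : ℂ) ^ (-(1 : ℂ))) ^ 2)) *
          ((∑ b : ZMod n₀, χ₀⁻¹ b * ((ratPlusSymbol f ((b.val : ℚ) / n₀) : ℚ) : ℂ)) /
            gaussSum χ₀⁻¹ (ZMod.stdAddChar (N := n₀)))) *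
        cuspFactor f true (fun j => (DirichletCharacter.changeLevel hn₀ χ₀)⁻¹ (j : ZMod n)) c d a A d')
    (lam : ι → (ZMod n)ˣ)
    (hlam : ∀ j, ((ZMod.unitsMap (prod_dvd_of_prod_eq ℓ hn (univ.erase j)) (lam j) :
      (ZMod (∏ i ∈ univ.erase j, ℓ i))ˣ) : ZMod (∏ i ∈ univ.erase j, ℓ i)) =
        (ℓ j : ZMod (∏ i ∈ univ.erase j, ℓ i)))
    (b : ι → (ZMod n)ˣ) (hb : ∀ i, b i ∈ (ZMod.unitsMap (prod_dvd_of_prod_eq ℓ hn (univ.erase i))).ker)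
    (Nq Dq gq Kq Mq : ι → MonoidAlgebra ℚ (ZMod n)ˣ)
    (hNq : ∀ i, Nq i = ∑ h ∈ univ.filter (· ∈ (ZMod.unitsMap (prod_dvd_of_prod_eq ℓ hn (univ.erase i))).ker),
      single h (1 : ℚ))
    (hDq : ∀ i, Dq i = ∑ j ∈ range (ℓ i - 1), single (b i ^ j) ((j : ℕ) : ℚ))
    (hgq : ∀ i, gq i = algebraMap ℚ _ (((ℓ i : ℚ) - 2) / 2))
    (hKq : ∀ i, Kq i = algebraMap ℚ _ (aℓ i : ℚ) - single (lam i)⁻¹ (1 : ℚ) - single (lam i) (ℓ i : ℚ))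
    (hMq : ∀ i, Mq i = algebraMap ℚ _ (aℓ i : ℚ) - single (lam i) (1 : ℚ) - single (lam i)⁻¹ (1 : ℚ))
    (uq : ℕ → (ZMod n)ˣ) (huq : ∀ q ∈ M.primeFactors, ((uq q : (ZMod n)ˣ) : ZMod n) = q)
    (aM : ℕ → ℤ) (haM : ∀ q ∈ M.primeFactors, cuspCoeff f q = aM q)
    (Eq : MonoidAlgebra ℚ (ZMod n)ˣ)
    (hEq : Eq = ∏ q ∈ M.primeFactors, (1 - single (uq q)⁻¹ ((aM q : ℚ) / q) +
      single ((uq q)⁻¹ ^ 2) (if q ∣ N then 0 else (1 / q : ℚ))))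
    (uc ud : (ZMod n)ˣ) (huc : (uc : ZMod n) = c) (hud : (ud : ZMod n) = d)
    (Cq : MonoidAlgebra ℚ (ZMod n)ˣ)
    (hCq : Cq = algebraMap ℚ _ ((c : ℚ) ^ 2 * (d : ℚ) ^ 2 * ratMinusSymbol f ((a : ℚ) / A)) -
      single uc ((c : ℚ) * (d : ℚ) ^ 2 * ratMinusSymbol f ((a * c : ℚ) / A)) -
      single ud ((c : ℚ) ^ 2 * (d : ℚ) * ratMinusSymbol f ((a * d' : ℚ) / A)) +
      single (uc * ud) ((c : ℚ) * (d : ℚ) * ratMinusSymbol f ((a * c * d' : ℚ) / A)))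
    (Vq : MonoidAlgebra ℚ (ZMod n)ˣ)
    (hVq : Vq = (1 + single (-1 : (ZMod n)ˣ) (1 : ℚ)) * single u⁻¹ κ * Eq * Cq)
    (Θq : Finset ι → MonoidAlgebra ℚ (ZMod n)ˣ)
    (hΘq : ∀ d : Finset ι,
      haveI : NeZero (∏ i ∈ d, ℓ i) := ⟨Finset.prod_ne_zero_iff.mpr fun i _ => (hℓ i).out.ne_zero⟩
      Θq d = ∑ g : (ZMod n)ˣ, single g (ratPlusSymbol f
        ((((ZMod.unitsMap (prod_dvd_of_prod_eq ℓ hn d) g : (ZMod (∏ i ∈ d, ℓ i))ˣ) :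
          ZMod (∏ i ∈ d, ℓ i)).val : ℚ) / (∏ i ∈ d, ℓ i : ℕ))))
    (p : ℕ) [Fact p.Prime] (hp2 : p ≠ 2) (K : ℕ) (hKℓ : ∀ i, p ^ K ∣ ℓ i - 1)
    (hint : ∀ m : ℕ, m ∣ n → ∀ t : ℕ, ‖((ratPlusSymbol f ((t : ℚ) / m) : ℚ) : ℚ_[p])‖ ≤ 1)
    (Θ : MonoidAlgebra ℤ_[p] (ZMod n)ˣ)
    (hΘ : ∀ g : (ZMod n)ˣ, ((Θ.coeff g : ℤ_[p]) : ℚ_[p]) =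
      ((ratPlusSymbol f (((g : ZMod n).val : ℚ) / n) : ℚ) : ℚ_[p]))
    (V : MonoidAlgebra ℤ_[p] (ZMod n)ˣ)
    (hV : MonoidAlgebra.mapRingHom (ZMod n)ˣ (PadicInt.Coe.ringHom (p := p)) V =
      MonoidAlgebra.mapRingHom (ZMod n)ˣ (algebraMap ℚ ℚ_[p]) Vq) :
    (∏ i, ∑ j : Fin (ℓ i - 1), MonoidAlgebra.single (b i ^ (j : ℕ)) ((j : ℕ) : ℚ_[p])) *
        (MonoidAlgebra.mapRingHom (ZMod n)ˣ (algebraMap ℚ ℚ_[p])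
            ((n : ℚ) • ((1 + MonoidAlgebra.single (-1 : (ZMod n)ˣ) (1 : ℚ)) * X)) -
          MonoidAlgebra.mapRingHom (ZMod n)ˣ (PadicInt.Coe.ringHom (p := p)) (Θ * V)) ∈
      (Ideal.span {((p : MonoidAlgebra ℤ_[p] (ZMod n)ˣ)) ^ K}).toAddSubmonoid.map
        (MonoidAlgebra.mapRingHom (ZMod n)ˣ (PadicInt.Coe.ringHom (p := p)) :
          MonoidAlgebra ℤ_[p] (ZMod n)ˣ →+ MonoidAlgebra ℚ_[p] (ZMod n)ˣ) := by
  classical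
  have hE1 := prod_deriv_mul_plusAvatar_sub_eq_sum ℓ hinj hn f hf hQ hℓN aℓ ha x X hxX ιe u hι κ hM0 hM c d a
    A d' hval lam hlam b hb Nq Dq gq Kq Mq hNq hDq hgq hKq hMq uq huq aM haM Eq hEq uc ud huc hud Cq hCq
    Vq hVq Θq hΘq
  -- the two coefficient maps
  have hE1p := congrArg (MonoidAlgebra.mapRingHom (ZMod n)ˣ (algebraMap ℚ ℚ_[p])) hE1
  rw [map_mul, map_sub, map_prod, map_mul] at hE1p
  simp only [map_sum, map_mul, map_prod, map_sub] at hE1p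
  -- identify the left-hand side
  have hD : ∀ i, MonoidAlgebra.mapRingHom (ZMod n)ˣ (algebraMap ℚ ℚ_[p]) (Dq i) =
      ∑ j : Fin (ℓ i - 1), single (b i ^ (j : ℕ)) ((j : ℕ) : ℚ_[p]) := fun i => by
    rw [Fin.sum_univ_eq_sum_range (fun j => single (b i ^ j) ((j : ℕ) : ℚ_[p])) (ℓ i - 1), hDq i, map_sum]
    exact Finset.sum_congr rfl fun j _ => by rw [MonoidAlgebra.mapRingHom_single, map_natCast]
  have hΘp : MonoidAlgebra.mapRingHom (ZMod n)ˣ (PadicInt.Coe.ringHom (p := p)) Θ =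
      MonoidAlgebra.mapRingHom (ZMod n)ˣ (algebraMap ℚ ℚ_[p]) (Θq univ) := by
    rw [eq_sum_single_coeff Θ, map_sum, hΘq univ, map_sum]
    refine Finset.sum_congr rfl fun g _ => ?_
    rw [MonoidAlgebra.mapRingHom_single, MonoidAlgebra.mapRingHom_single, eq_ratCast,
      val_unitsMap_eq_of_eq hn (prod_dvd_of_prod_eq ℓ hn univ) g, hn]
    exact congrArg _ (hΘ g)
  rw [map_mul _ Θ V, hΘp, hV, mul_comm (MonoidAlgebra.mapRingHom (ZMod n)ˣ (algebraMap ℚ ℚ_[p]) (Θq univ)),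
    show (∏ i, ∑ j : Fin (ℓ i - 1), single (b i ^ (j : ℕ)) ((j : ℕ) : ℚ_[p])) =
      ∏ i, MonoidAlgebra.mapRingHom (ZMod n)ˣ (algebraMap ℚ ℚ_[p]) (Dq i) from
      Finset.prod_congr rfl fun i _ => (hD i).symm, hE1p]
  -- integrality of the right-hand side (PK-4b-C3 `sum_mem_map_of_images`)
  have h2 : IsUnit ((2 : ℕ) : ℤ_[p]) := by
    rw [PadicInt.isUnit_iff, PadicInt.norm_def, PadicInt.coe_natCast, Padic.norm_natCast_eq_one_iff]
    exact (Nat.coprime_primes Fact.out Nat.prime_two).mpr hp2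
  obtain ⟨w2, hw2⟩ := h2.exists_left_inv
  rw [Nat.cast_ofNat] at hw2
  have hw2' : (w2 : ℚ_[p]) * 2 = 1 := by
    have h := congrArg (PadicInt.Coe.ringHom (p := p)) hw2
    rw [map_mul, map_one, map_ofNat] at h
    exact h
  have hg : ∀ i, ∃ z : MonoidAlgebra ℤ_[p] (ZMod n)ˣ,
      MonoidAlgebra.mapRingHom (ZMod n)ˣ (PadicInt.Coe.ringHom (p := p)) z =
        MonoidAlgebra.mapRingHom (ZMod n)ˣ (algebraMap ℚ ℚ_[p]) (gq i) := fun i => by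
    refine ⟨algebraMap ℤ_[p] _ ((((ℓ i : ℤ) - 2 : ℤ) : ℤ_[p]) * w2), ?_⟩
    rw [mapRingHom_coe_algebraMap, hgq i, mapRingHom_algebraMap_algebraMap, PadicInt.coe_mul,
      PadicInt.coe_intCast]
    congr 1
    push_cast
    linear_combination (((ℓ i : ℚ_[p]) - 2) / 2) * hw2'
  choose zg hzg using hg
  have hDz : ∀ i, ∃ z : MonoidAlgebra ℤ_[p] (ZMod n)ˣ,
      MonoidAlgebra.mapRingHom (ZMod n)ˣ (PadicInt.Coe.ringHom (p := p)) z =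
        MonoidAlgebra.mapRingHom (ZMod n)ˣ (algebraMap ℚ ℚ_[p]) (Dq i) -
          MonoidAlgebra.mapRingHom (ZMod n)ˣ (algebraMap ℚ ℚ_[p]) (gq i) *
            MonoidAlgebra.mapRingHom (ZMod n)ˣ (algebraMap ℚ ℚ_[p]) (Nq i) := fun i => by
    have h1 : MonoidAlgebra.mapRingHom (ZMod n)ˣ (PadicInt.Coe.ringHom (p := p))
        (∑ j ∈ range (ℓ i - 1), single (b i ^ j) ((j : ℕ) : ℤ_[p])) =
        MonoidAlgebra.mapRingHom (ZMod n)ˣ (algebraMap ℚ ℚ_[p]) (Dq i) := by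
      rw [hDq i, map_sum, map_sum]
      exact Finset.sum_congr rfl fun j _ => by
        rw [MonoidAlgebra.mapRingHom_single, MonoidAlgebra.mapRingHom_single, map_natCast, map_natCast]
    have h2 : MonoidAlgebra.mapRingHom (ZMod n)ˣ (PadicInt.Coe.ringHom (p := p))
        (∑ h ∈ univ.filter (· ∈ (ZMod.unitsMap (prod_dvd_of_prod_eq ℓ hn (univ.erase i))).ker),
          single h (1 : ℤ_[p])) =
        MonoidAlgebra.mapRingHom (ZMod n)ˣ (algebraMap ℚ ℚ_[p]) (Nq i) := by
      rw [hNq i, map_sum, map_sum]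
      exact Finset.sum_congr rfl fun h _ => by
        rw [MonoidAlgebra.mapRingHom_single, MonoidAlgebra.mapRingHom_single, map_one, map_one]
    exact ⟨(∑ j ∈ range (ℓ i - 1), single (b i ^ j) ((j : ℕ) : ℤ_[p])) - zg i *
      ∑ h ∈ univ.filter (· ∈ (ZMod.unitsMap (prod_dvd_of_prod_eq ℓ hn (univ.erase i))).ker),
        single h (1 : ℤ_[p]), by rw [map_sub, map_mul, hzg i, h1, h2]⟩
  have hKM : ∀ U : Finset ι, U ≠ ∅ → ∃ z ∈ Ideal.span {((p : MonoidAlgebra ℤ_[p] (ZMod n)ˣ)) ^ K},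
      MonoidAlgebra.mapRingHom (ZMod n)ˣ (PadicInt.Coe.ringHom (p := p)) z =
        (∏ i ∈ U, MonoidAlgebra.mapRingHom (ZMod n)ˣ (algebraMap ℚ ℚ_[p]) (Kq i)) -
          ∏ i ∈ U, MonoidAlgebra.mapRingHom (ZMod n)ˣ (algebraMap ℚ ℚ_[p]) (Mq i) := fun U _ => by
    refine exists_mem_map_eq_prod_sub_prod _ _ _ _
      (fun i => algebraMap ℤ_[p] _ (aℓ i : ℤ_[p]) - single (lam i)⁻¹ (1 : ℤ_[p]) - single (lam i) (ℓ i : ℤ_[p]))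
      (fun i => algebraMap ℤ_[p] _ (aℓ i : ℤ_[p]) - single (lam i) (1 : ℤ_[p]) - single (lam i)⁻¹ (1 : ℤ_[p]))
      U (fun i _ => ?_) (fun i _ => ?_) (fun i _ => ?_)
    · rw [hKq i]
      simp only [map_sub, mapRingHom_coe_algebraMap, mapRingHom_algebraMap_algebraMap,
        MonoidAlgebra.mapRingHom_single, map_one, map_natCast, PadicInt.coe_intCast, Rat.cast_intCast]
    · rw [hMq i]
      simp only [map_sub, mapRingHom_coe_algebraMap, mapRingHom_algebraMap_algebraMap,
        MonoidAlgebra.mapRingHom_single, map_one, PadicInt.coe_intCast, Rat.cast_intCast]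
    · obtain ⟨t, ht⟩ := hKℓ i
      have hℓt : (ℓ i : ℤ_[p]) = (p : ℤ_[p]) ^ K * t + 1 := by
        have h1 : 1 ≤ ℓ i := (hℓ i).out.one_lt.le
        have h' : ((ℓ i - 1 : ℕ) : ℤ_[p]) + 1 = (p : ℤ_[p]) ^ K * t + 1 := by rw [ht]; push_cast; ring
        rwa [Nat.cast_sub h1, Nat.cast_one, sub_add_cancel] at h'
      refine Ideal.mem_span_singleton'.mpr ⟨-single (lam i) (t : ℤ_[p]), ?_⟩
      rw [MonoidAlgebra.natCast_def, MonoidAlgebra.single_pow, one_pow, neg_mul, single_mul_single, mul_one,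
        hℓt]
      have h' : single (lam i) (1 : ℤ_[p]) - single (lam i) ((p : ℤ_[p]) ^ K * t + 1) =
          -single (lam i) ((t : ℤ_[p]) * (p : ℤ_[p]) ^ K) := by
        rw [← MonoidAlgebra.single_sub, ← MonoidAlgebra.single_neg]
        congr 1
        ring
      rw [← h']
      ring
  have hY : ∀ e : Finset ι, ∃ z : MonoidAlgebra ℤ_[p] (ZMod n)ˣ,
      MonoidAlgebra.mapRingHom (ZMod n)ˣ (PadicInt.Coe.ringHom (p := p)) z =
        MonoidAlgebra.mapRingHom (ZMod n)ˣ (algebraMap ℚ ℚ_[p]) Vq *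
          MonoidAlgebra.mapRingHom (ZMod n)ˣ (algebraMap ℚ ℚ_[p]) (Θq e) := fun e => by
    haveI : NeZero (∏ i ∈ e, ℓ i) := ⟨Finset.prod_ne_zero_iff.mpr fun i _ => (hℓ i).out.ne_zero⟩
    let θz : (ZMod n)ˣ → ℤ_[p] := fun g => ⟨((ratPlusSymbol f
      ((((ZMod.unitsMap (prod_dvd_of_prod_eq ℓ hn e) g : (ZMod (∏ i ∈ e, ℓ i))ˣ) :
        ZMod (∏ i ∈ e, ℓ i)).val : ℚ) / (∏ i ∈ e, ℓ i : ℕ)) : ℚ) : ℚ_[p]),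
      hint _ (prod_dvd_of_prod_eq ℓ hn e) _⟩
    have hθz : ∀ g, PadicInt.Coe.ringHom (p := p) (θz g) = algebraMap ℚ ℚ_[p] (ratPlusSymbol f
        ((((ZMod.unitsMap (prod_dvd_of_prod_eq ℓ hn e) g : (ZMod (∏ i ∈ e, ℓ i))ˣ) :
          ZMod (∏ i ∈ e, ℓ i)).val : ℚ) / (∏ i ∈ e, ℓ i : ℕ))) := fun g => by
      rw [eq_ratCast]; rfl
    have hΘz : MonoidAlgebra.mapRingHom (ZMod n)ˣ (PadicInt.Coe.ringHom (p := p))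
        (∑ g : (ZMod n)ˣ, single g (θz g)) =
        MonoidAlgebra.mapRingHom (ZMod n)ˣ (algebraMap ℚ ℚ_[p]) (Θq e) := by
      rw [hΘq e, map_sum, map_sum]
      exact Finset.sum_congr rfl fun g _ => by
        rw [MonoidAlgebra.mapRingHom_single, MonoidAlgebra.mapRingHom_single, hθz g]
    exact ⟨V * ∑ g : (ZMod n)ˣ, single g (θz g), by rw [map_mul, hV, hΘz]⟩
  exact sum_mem_map_of_images (MonoidAlgebra.mapRingHom (ZMod n)ˣ (PadicInt.Coe.ringHom (p := p))) _
    (fun i => MonoidAlgebra.mapRingHom (ZMod n)ˣ (algebraMap ℚ ℚ_[p]) (gq i))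
    (fun i => MonoidAlgebra.mapRingHom (ZMod n)ˣ (algebraMap ℚ ℚ_[p]) (Dq i) -
      MonoidAlgebra.mapRingHom (ZMod n)ˣ (algebraMap ℚ ℚ_[p]) (gq i) *
        MonoidAlgebra.mapRingHom (ZMod n)ˣ (algebraMap ℚ ℚ_[p]) (Nq i))
    (fun U => (∏ i ∈ U, MonoidAlgebra.mapRingHom (ZMod n)ˣ (algebraMap ℚ ℚ_[p]) (Kq i)) -
      ∏ i ∈ U, MonoidAlgebra.mapRingHom (ZMod n)ˣ (algebraMap ℚ ℚ_[p]) (Mq i))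
    (fun e => MonoidAlgebra.mapRingHom (ZMod n)ˣ (algebraMap ℚ ℚ_[p]) Vq *
      MonoidAlgebra.mapRingHom (ZMod n)ˣ (algebraMap ℚ ℚ_[p]) (Θq e))
    (fun i => ⟨zg i, hzg i⟩) hDz hKM hY

/-! ### Integral lifts: tools for discharging `hV` -/

section Lifts

variable {n : ℕ} {p : ℕ} [Fact p.Prime]

/-- **Coefficientwise `p`-integral elements of `ℚ[(ℤ/n)ˣ]` lift to `ℤ_p[(ℤ/n)ˣ]`**: if every
coefficient of `Z` has `p`-adic norm `≤ 1`, there is `Z^int` with `(Z^int)^{ℚ_p} = Z^{ℚ_p}` — the shape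
of the hypothesis `hV` of `prod_deriv_mul_plusAvatar_sub_mem_map_span`. [folklore] -/
theorem exists_lift_of_forall_norm_coeff_le_one [NeZero n] (Z : MonoidAlgebra ℚ (ZMod n)ˣ)
    (h : ∀ g : (ZMod n)ˣ, ‖((Z.coeff g : ℚ) : ℚ_[p])‖ ≤ 1) :
    ∃ Zi : MonoidAlgebra ℤ_[p] (ZMod n)ˣ,
      MonoidAlgebra.mapRingHom (ZMod n)ˣ (PadicInt.Coe.ringHom (p := p)) Zi =
        MonoidAlgebra.mapRingHom (ZMod n)ˣ (algebraMap ℚ ℚ_[p]) Z := by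
  classical
  refine ⟨∑ g : (ZMod n)ˣ, single g (⟨((Z.coeff g : ℚ) : ℚ_[p]), h g⟩ : ℤ_[p]), ?_⟩
  conv_rhs => rw [eq_sum_single_coeff Z]
  rw [map_sum, map_sum]
  refine Finset.sum_congr rfl fun g _ => ?_
  rw [MonoidAlgebra.mapRingHom_single, MonoidAlgebra.mapRingHom_single, eq_ratCast]
  rfl

/-- Lifts multiply: if `Z₁`, `Z₂` lift then so does `Z₁ Z₂` (so the twist
`V = (1 + δ₋₁) · κδ_{u⁻¹} · E · C⁻` lifts factor by factor). [folklore] -/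
theorem exists_lift_mul {Z₁ Z₂ : MonoidAlgebra ℚ (ZMod n)ˣ}
    (h₁ : ∃ Zi : MonoidAlgebra ℤ_[p] (ZMod n)ˣ,
      MonoidAlgebra.mapRingHom (ZMod n)ˣ (PadicInt.Coe.ringHom (p := p)) Zi =
        MonoidAlgebra.mapRingHom (ZMod n)ˣ (algebraMap ℚ ℚ_[p]) Z₁)
    (h₂ : ∃ Zi : MonoidAlgebra ℤ_[p] (ZMod n)ˣ,
      MonoidAlgebra.mapRingHom (ZMod n)ˣ (PadicInt.Coe.ringHom (p := p)) Zi =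
        MonoidAlgebra.mapRingHom (ZMod n)ˣ (algebraMap ℚ ℚ_[p]) Z₂) :
    ∃ Zi : MonoidAlgebra ℤ_[p] (ZMod n)ˣ,
      MonoidAlgebra.mapRingHom (ZMod n)ˣ (PadicInt.Coe.ringHom (p := p)) Zi =
        MonoidAlgebra.mapRingHom (ZMod n)ˣ (algebraMap ℚ ℚ_[p]) (Z₁ * Z₂) := by
  obtain ⟨W₁, hW₁⟩ := h₁
  obtain ⟨W₂, hW₂⟩ := h₂
  exact ⟨W₁ * W₂, by rw [map_mul, map_mul, hW₁, hW₂]⟩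

/-- Lifts of finite products (the depletion element `E = ∏_{q ∣ M} E_q` lifts factor by factor).
[folklore] -/
theorem exists_lift_prod {β : Type*} (s : Finset β) (Z : β → MonoidAlgebra ℚ (ZMod n)ˣ)
    (h : ∀ q ∈ s, ∃ Zi : MonoidAlgebra ℤ_[p] (ZMod n)ˣ,
      MonoidAlgebra.mapRingHom (ZMod n)ˣ (PadicInt.Coe.ringHom (p := p)) Zi =
        MonoidAlgebra.mapRingHom (ZMod n)ˣ (algebraMap ℚ ℚ_[p]) (Z q)) :
    ∃ Zi : MonoidAlgebra ℤ_[p] (ZMod n)ˣ,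
      MonoidAlgebra.mapRingHom (ZMod n)ˣ (PadicInt.Coe.ringHom (p := p)) Zi =
        MonoidAlgebra.mapRingHom (ZMod n)ˣ (algebraMap ℚ ℚ_[p]) (∏ q ∈ s, Z q) := by
  classical
  induction s using Finset.induction_on with
  | empty => exact ⟨1, by rw [Finset.prod_empty, map_one, map_one]⟩
  | insert q s hq ih =>
    rw [Finset.prod_insert hq]
    exact exists_lift_mul (h q (Finset.mem_insert_self q s))
      (ih fun q' hq' => h q' (Finset.mem_insert_of_mem hq'))

/-- **The depletion factor at an ADDITIVE prime is trivial**: if `a_q = 0` and `q ∣ N` (additive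
reduction of the curve at `q`, e.g. the cell's `q = p = 3` for class X4) then
`E_q = 1 − (a_q/q) δ_{[q]⁻¹} + 𝟙_{q∤N} q⁻¹ δ_{[q]⁻²} = 1` — no `p`-denominator enters `V` from `E_p`.
(At a good or multiplicative `p` the factor `E_p` is NOT `p`-integral; there a `p^t`-scaled variant of
the congruence is needed, which this file does not provide.) [cite: Kato2004Asterisque, §6.2 (p. 161)] -/
theorem depletionFactor_eq_one_of_additive {N q : ℕ} (hqN : q ∣ N) (v w : (ZMod n)ˣ) (aq : ℤ)
    (haq : aq = 0) :
    (1 - single v ((aq : ℚ) / q) + single w (if q ∣ N then 0 else (1 / q : ℚ)) :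
      MonoidAlgebra ℚ (ZMod n)ˣ) = 1 := by
  rw [haq, if_pos hqN, Int.cast_zero, zero_div, single_zero, single_zero, sub_zero, add_zero]

end Lifts

end EulerFactorComparison

end Summit.BirchSwinnertonDyer.Rank1Residual.GaloisImage

end
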